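import Summits.QuantumFields.YangMills.Theorems.BalabanUVNodesN15KingModelCoverBlockGauge
import Literature.MathematicalPhysics.QuantumFieldTheory.King1986.CovarianceQstarRate
import HarnessLib

/-!
# BalabanUVNodes ∕ N15 — THE KING-MODEL RUNG (PART Ͻ-h): FINITE COVERS — KING's LEMMA 4.5 AT A TORON: THE TWO-SPACING `η`-RATE OF THE BLOCK-FIELD COVARIANCE WITH
# POSITION-SPACE EXPONENTIAL DECAY, `|(Δ^{(k+n)}_ω)⁻¹(b,b′) − (Δ^{(k)}_ω)⁻¹(b,b′)| ≤ C_diff·L^{−k}·Σ_{images} e^{−(κ_m∕2)·dist}`, AT EVERY TORON WHOSE HOLONOMY HAS FINITE ORDER —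
# by the tree's `King1986.Torus.effLaplacian_inv_sub_decay` ON A FINITE COVER, BY NAME, and the method of images (door (t3⁴⁹) of the seat's §g44)
# (Track A, DAG node N15 = NE2; FAN-OUT v1.1 §N15 s3 «KING-MODEL RUNG … NE2's analogue DECIDED in the model … + what the curved case adds»; count-neutral)

HONEST FRAMING.  Count-neutral (cell `pub-ymgap`, seat `pub-ymgap-dag-n15-e` g45; `--supports stmt-QuantumFields-27247 --as helper` = K3ᴬ, KEY MAP v3).  King's `A = 0`
comparison model [King1986] at a constant abelian (flat) link field — the simplest LIVE background; NE2's unit-lattice layer (the η-rate of the unit-lattice covariance `C^{(k)}`,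
[King1986] Lemma 4.5 (4.38) p.674 «|C^{(k)}(x,y) − C^{(k+n)}(x,y)| ≤ CL^{−k}e^{−δ₀|x−y|}», the tree's `T4EtaRate.EtaRateIneqUnit` shape) is DECIDED here for the effective-Laplacian
part `(Δ^{(k)})⁻¹` AT A TORON, with King's constants of the tree (`CdiffM`, `kapM`, `gamM` of `King1986.CovarianceQstarRate`∕`…Decay`) and the exponential majorant PERIODISED over
the finite cover that trivialises the holonomy.  One finite torus at fixed spacings; NOT Bałaban's `G_k(U)` ([Balaban1985BackgroundPropagators] (3.42)∕Thm 3.15 untouched);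
NOT a node discharge (N15 of record untouched — discharged by n15-a); nothing continuum ∕ ℝ⁴ ∕ OS ∕ Clay.

THE MATHEMATICS.  (1) On a unit torus `T_{M′}` where the toron's phases satisfy `ω_μ^{L^kM′_μ} = 1` (trivial holonomy of the fine field) PART Ͻ-f gives
`|(Δ^ω_{eff,k})⁻¹(b,b′)| = |(Δ_{eff,k})⁻¹(b,b′)|` and, for two spacings `L^{−k}`, `L^{−k−n}` reading the SAME constant gauge field (`ω₂^{L^{n+k}} = ω₁^{L^k}`),
`|(Δ^{ω₂}_{eff,k+n})⁻¹ − (Δ^{ω₁}_{eff,k})⁻¹|(b,b′) = |(Δ_{eff,k+n})⁻¹ − (Δ_{eff,k})⁻¹|(b,b′)` — so the tree's `effLaplacian_inv_decay` ((4.34)) and `effLaplacian_inv_sub_decay`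
((4.39)–(4.41)) hold AT THE TORON VERBATIM.  (2) On the base torus `T_M` (`M_μ ∣ M′_μ`), where the same phases have holonomy `ω_μ^{L^kM_μ}` of finite order `M′_μ∕M_μ`, PART Ͻ-e's
method of images gives the same bounds with the exponential majorant summed over the fibre: `Σ_{b̃′ : π b̃′ = b} e^{−κ·d_{M′}(b̃, b̃′)}` (closed form in PART Ͻ-h′).
PROVED HERE:
* §1 (trivial holonomy) ★★ **`norm_effLapTw_inv_apply_le_decay`** (`|(Δ^ω_{eff,k})⁻¹(b,b′)| ≤ (2∕γ_m)e^{−κ_m d(b,b′)}`), ★★★ **`norm_effLapTw_inv_sub_apply_le_rate`** (`≤ C_diff·L^{−k}·e^{−(κ_m∕2)d(b,b′)}`);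
* §2 (finite-order holonomy, base torus) ★★ **`norm_effLapTw_inv_apply_le_decay_cover`**, ★★★ **`norm_effLapTw_inv_sub_apply_le_rate_cover`** — KING's LEMMA 4.5 RATE `L^{−k}` WITH DECAY AT
  THE TORON, majorant `C_diff·L^{−k}·Σ_{fibre}e^{−(κ_m∕2)d_{M′}(b̃,b̃′)}`; `…_cover'` variants with the canonical lift; `effLapTw_toron_rate_package` (the conjunction).
PRIOR TREE ART (by name): `King1986.Torus.effLaplacian_inv_decay`, `effLaplacian_inv_sub_decay`, `CdiffM`, `kapM`, `gamM`, `tdistT`, `King1986.aK`∕`aK_pos`; Ͻ-d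
(`exists_char_of_pow_eq_one`, `norm_eq_one_of_pow_period`), Ͻ-e (`norm_effLapTw_inv_apply_le_of_cover`, `norm_effLapTw_inv_sub_apply_le_of_cover`), Ͻ-f (`norm_effLapTw_inv_apply_eq`,
`norm_effLapTw_inv_sub_apply_eq`), Ͻ-b (`proj`, `lift`, `proj_lift`, `fiber`).  Dedup (rg at filing): basename 0 files; needles
`norm_effLapTw_inv_sub_apply_le_rate|norm_effLapTw_inv_apply_le_decay|toron_rate_package` 0 tree files.  presearch: «η-rate ∕ two-spacing convergence of block-spin covariances
at twisted (flat-connection) boundary conditions via covering tori» — corpus∕galaxy: none specific beyond King 1986 §4 (A = 0 estimates) and 't Hooft's twisted b.c.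
(notion); the transfer is this file's composition.  Locators: [King1986] Lemma 4.5 (4.38) p.674, (4.34) p.674, (4.39)–(4.41) pp.674–675, (2.16) p.653;
[Balaban1985BackgroundPropagators] Thm 3.15 (3.187) p.432 (the unit-lattice layer NE2 shapes), p.398 l.19.  0 `sorry`, 0 `def`.
v1.1 (DOC-ONLY, ERRATUM-Ͻ1 = ref-I READ-1034 N2): v1.0 cited «[King1986] §4 p.670 l.8–13» as «the method of images»; King's lines invoke [Ba 4]'s MULTIPLE-REFLECTION
representations (box propagators ∕ free boundary conditions ∕ the (2.13) operator on `ηℤ^d`, `A = 0`), not a periodisation — the finite-cover image sum is an elementary device of these files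
([folklore]); that locator is withdrawn from the affected docstrings, every other locator stands; declarations byte-identical to v1.0.
-/

noncomputable section

open scoped BigOperators ComplexConjugate ComplexOrder
open Finset Matrix

namespace Summit.QuantumFields.YangMills.BalabanUVNodes.N15KingModelRung.Cover

open Literature.MathematicalPhysics.QuantumFieldTheory.Balaban1983to89.B5Prop11Plancherel (Tor unitVec fine chi)
open Literature.MathematicalPhysics.QuantumFieldTheory.King1986 (aK aK_pos)
open Literature.MathematicalPhysics.QuantumFieldTheory.King1986.Torus (effLaplacian effLaplacian_inv_decay effLaplacian_inv_sub_decay CdiffM kapM gamM tdistT)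
open Summit.QuantumFields.YangMills.BalabanUVNodes.N15KingModelRung.Toron (effLapTw)

variable {d : ℕ}

/-! ## §1 Trivial holonomy: King's decay and two-spacing rate hold at the toron verbatim -/

section Trivial

variable (M' : Fin (d + 1) → ℕ) [hM' : ∀ μ, NeZero (M' μ)]

/-- ★★ **UNIFORM EXPONENTIAL DECAY OF THE TORON BLOCK-FIELD COVARIANCE AT TRIVIAL HOLONOMY**: `|(Δ^ω_{eff,k})⁻¹(b,b′)| ≤ (2∕γ_m)·e^{−κ_m·d(b,b′)}` on every unit torus `T_{M′}`,
for every phase vector with `ω_μ^{L^kM′_μ} = 1` — the tree's (4.34)-type bound `effLaplacian_inv_decay`, at the toron, with the same constants. [cite: King1986, (4.34) p.674, (2.16) p.653] -/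
theorem norm_effLapTw_inv_apply_le_decay {a m2 : ℝ} (ha : 0 < a) (hm : 0 < m2) {L k : ℕ} [NeZero L] (hL : 2 ≤ L) (hk : 1 ≤ k)
    {ω : Fin (d + 1) → ℂ} (hω : ∀ μ, ω μ ^ fine (L ^ k) M' μ = 1) (b b' : Tor M') :
    ‖(effLapTw (L ^ k) M' (aK a L k) (((L ^ k : ℕ) : ℝ) ^ 2) m2 ω)⁻¹ b b'‖
      ≤ (2 / gamM a m2 L) * Real.exp (-(kapM (d + 1) a m2 L * tdistT M' b b')) := by
  rw [norm_effLapTw_inv_apply_eq (L ^ k) M' (aK_pos ha (by exact_mod_cast hL) hk) (sq_nonneg _) hm hω]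
  exact effLaplacian_inv_decay ha hm hL hk M' b b'

/-- ★★★ **KING's LEMMA 4.5 TWO-SPACING RATE WITH DECAY AT A TORON OF TRIVIAL HOLONOMY**: for phases `ω₁` (spacing `L^{−k}`) and `ω₂` (spacing `L^{−k−n}`) with trivial holonomy on
`T_{M′}` and THE SAME UNIT-LATTICE PHASES `ω₂^{L^nL^k} = ω₁^{L^k}` (one constant gauge field read at two spacings),
`|(Δ^{ω₂}_{eff,k+n})⁻¹(b,b′) − (Δ^{ω₁}_{eff,k})⁻¹(b,b′)| ≤ C_diff·L^{−k}·e^{−(κ_m∕2)·d(b,b′)}` — the tree's `effLaplacian_inv_sub_decay` at the toron, same constants.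
[cite: King1986, Lemma 4.5 (4.38) p.674, (4.39)–(4.41) pp.674–675] -/
theorem norm_effLapTw_inv_sub_apply_le_rate {a m2 : ℝ} (ha : 0 < a) (hm : 0 < m2) {L k n : ℕ} [NeZero L] (hL : 2 ≤ L) (hk : 1 ≤ k) (hn : 1 ≤ n)
    {ω₁ ω₂ : Fin (d + 1) → ℂ} (hω₁ : ∀ μ, ω₁ μ ^ fine (L ^ k) M' μ = 1) (hω₂ : ∀ μ, ω₂ μ ^ fine (L ^ n * L ^ k) M' μ = 1)
    (hθ : ∀ μ, ω₂ μ ^ (L ^ n * L ^ k) = ω₁ μ ^ (L ^ k)) (b b' : Tor M') :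
    ‖(effLapTw (L ^ n * L ^ k) M' (aK a L (k + n)) (((L ^ n * L ^ k : ℕ) : ℝ) ^ 2) m2 ω₂)⁻¹ b b'
        - (effLapTw (L ^ k) M' (aK a L k) (((L ^ k : ℕ) : ℝ) ^ 2) m2 ω₁)⁻¹ b b'‖
      ≤ CdiffM (d + 1) a m2 L * ((L : ℝ) ^ k)⁻¹ * Real.exp (-(kapM (d + 1) a m2 L / 2 * tdistT M' b b')) := by
  have hL1 : (1 : ℝ) < L := by exact_mod_cast hL
  obtain ⟨p₁, hp₁⟩ := exists_char_of_pow_eq_one (fine (L ^ k) M') hω₁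
  obtain ⟨p₂, hp₂⟩ := exists_char_of_pow_eq_one (fine (L ^ n * L ^ k) M') hω₂
  have hθ' : ∀ μ, chi (fine (L ^ n * L ^ k) M') p₂ (unitVec (fine (L ^ n * L ^ k) M') μ) ^ (L ^ n * L ^ k)
      = chi (fine (L ^ k) M') p₁ (unitVec (fine (L ^ k) M') μ) ^ (L ^ k) := fun μ => by rw [hp₁, hp₂, hθ]
  rw [norm_effLapTw_inv_sub_apply_eq M' (L ^ n * L ^ k) (L ^ k) (aK_pos ha hL1 (by omega)) (aK_pos ha hL1 hk) (sq_nonneg _) (sq_nonneg _) hm hp₂ hp₁ hθ' b b']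
  exact effLaplacian_inv_sub_decay ha hm hL hk hn M' b b'

end Trivial

/-! ## §2 Finite-order holonomy: the same estimates on the base torus, periodised over the cover -/

section Base

variable {M M' : Fin (d + 1) → ℕ} [hM : ∀ μ, NeZero (M μ)] [hM' : ∀ μ, NeZero (M' μ)]

/-- ★★ **DECAY OF THE TORON BLOCK-FIELD COVARIANCE ON THE BASE TORUS, PERIODISED**: for `M_μ ∣ M′_μ` and phases with `ω_μ^{L^kM′_μ} = 1` (holonomy of finite order on `T_M`),
`|(Δ^ω_{eff,k})⁻¹_{T_M}(π b̃, b)| ≤ (2∕γ_m)·Σ_{b̃′ : π b̃′ = b} e^{−κ_m·d_{M′}(b̃, b̃′)}`. [cite: King1986, (4.34) p.674] -/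
theorem norm_effLapTw_inv_apply_le_decay_cover (h : ∀ μ, M μ ∣ M' μ) {a m2 : ℝ} (ha : 0 < a) (hm : 0 < m2) {L k : ℕ} [NeZero L] (hL : 2 ≤ L) (hk : 1 ≤ k)
    {ω : Fin (d + 1) → ℂ} (hω : ∀ μ, ω μ ^ fine (L ^ k) M' μ = 1) (b' : Tor M') (b : Tor M) :
    ‖(effLapTw (L ^ k) M (aK a L k) (((L ^ k : ℕ) : ℝ) ^ 2) m2 ω)⁻¹ (proj h b') b‖
      ≤ (2 / gamM a m2 L) * ∑ b'' ∈ fiber (proj h) b, Real.exp (-(kapM (d + 1) a m2 L * tdistT M' b' b'')) := by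
  rw [Finset.mul_sum]
  exact norm_effLapTw_inv_apply_le_of_cover (L ^ k) h (aK_pos ha (by exact_mod_cast hL) hk) (sq_nonneg _) hm (norm_eq_one_of_pow_period (fine (L ^ k) M') hω)
    (fun b' b'' => norm_effLapTw_inv_apply_le_decay M' ha hm hL hk hω b' b'') b' b

/-- ★★★ **KING's LEMMA 4.5 TWO-SPACING RATE WITH DECAY AT A TORON OF FINITE-ORDER HOLONOMY** (door (t3⁴⁹) of the seat's §g44): on the base unit torus `T_M` under the covering
`π : T_{M′} → T_M` (`M_μ ∣ M′_μ`), for phases `ω₁` (spacing `L^{−k}`), `ω₂` (spacing `L^{−k−n}`) with trivial holonomy on the cover (`ω₁^{L^kM′} = ω₂^{L^nL^kM′} = 1`) and the same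
unit-lattice phases (`ω₂^{L^nL^k} = ω₁^{L^k}`):
`|(Δ^{ω₂}_{eff,k+n})⁻¹_{T_M}(π b̃, b) − (Δ^{ω₁}_{eff,k})⁻¹_{T_M}(π b̃, b)| ≤ C_diff·L^{−k}·Σ_{b̃′ : π b̃′ = b} e^{−(κ_m∕2)·d_{M′}(b̃, b̃′)}` — the printed `A = 0` estimate ((4.38)–(4.41),
tree `effLaplacian_inv_sub_decay`) on the cover, pushed down by the method of images. [cite: King1986, Lemma 4.5 (4.38) p.674, (4.39)–(4.41) pp.674–675] -/
theorem norm_effLapTw_inv_sub_apply_le_rate_cover (h : ∀ μ, M μ ∣ M' μ) {a m2 : ℝ} (ha : 0 < a) (hm : 0 < m2) {L k n : ℕ} [NeZero L] (hL : 2 ≤ L) (hk : 1 ≤ k)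
    (hn : 1 ≤ n) {ω₁ ω₂ : Fin (d + 1) → ℂ} (hω₁ : ∀ μ, ω₁ μ ^ fine (L ^ k) M' μ = 1) (hω₂ : ∀ μ, ω₂ μ ^ fine (L ^ n * L ^ k) M' μ = 1)
    (hθ : ∀ μ, ω₂ μ ^ (L ^ n * L ^ k) = ω₁ μ ^ (L ^ k)) (b' : Tor M') (b : Tor M) :
    ‖(effLapTw (L ^ n * L ^ k) M (aK a L (k + n)) (((L ^ n * L ^ k : ℕ) : ℝ) ^ 2) m2 ω₂)⁻¹ (proj h b') b
        - (effLapTw (L ^ k) M (aK a L k) (((L ^ k : ℕ) : ℝ) ^ 2) m2 ω₁)⁻¹ (proj h b') b‖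
      ≤ CdiffM (d + 1) a m2 L * ((L : ℝ) ^ k)⁻¹ * ∑ b'' ∈ fiber (proj h) b, Real.exp (-(kapM (d + 1) a m2 L / 2 * tdistT M' b' b'')) := by
  have hL1 : (1 : ℝ) < L := by exact_mod_cast hL
  rw [Finset.mul_sum]
  exact norm_effLapTw_inv_sub_apply_le_of_cover (L ^ n * L ^ k) (L ^ k) h (aK_pos ha hL1 (by omega)) (aK_pos ha hL1 hk) (sq_nonneg _) (sq_nonneg _) hm
    (norm_eq_one_of_pow_period (fine (L ^ n * L ^ k) M') hω₂) (norm_eq_one_of_pow_period (fine (L ^ k) M') hω₁)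
    (fun b' b'' => norm_effLapTw_inv_sub_apply_le_rate M' ha hm hL hk hn hω₁ hω₂ hθ b' b'') b' b

/-- The same at a base point `b₀`, with the canonical lift `lift h b₀` on the cover. [cite: King1986, Lemma 4.5 (4.38) p.674] -/
theorem norm_effLapTw_inv_sub_apply_le_rate_cover' (h : ∀ μ, M μ ∣ M' μ) {a m2 : ℝ} (ha : 0 < a) (hm : 0 < m2) {L k n : ℕ} [NeZero L] (hL : 2 ≤ L) (hk : 1 ≤ k)
    (hn : 1 ≤ n) {ω₁ ω₂ : Fin (d + 1) → ℂ} (hω₁ : ∀ μ, ω₁ μ ^ fine (L ^ k) M' μ = 1) (hω₂ : ∀ μ, ω₂ μ ^ fine (L ^ n * L ^ k) M' μ = 1)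
    (hθ : ∀ μ, ω₂ μ ^ (L ^ n * L ^ k) = ω₁ μ ^ (L ^ k)) (b₀ b : Tor M) :
    ‖(effLapTw (L ^ n * L ^ k) M (aK a L (k + n)) (((L ^ n * L ^ k : ℕ) : ℝ) ^ 2) m2 ω₂)⁻¹ b₀ b
        - (effLapTw (L ^ k) M (aK a L k) (((L ^ k : ℕ) : ℝ) ^ 2) m2 ω₁)⁻¹ b₀ b‖
      ≤ CdiffM (d + 1) a m2 L * ((L : ℝ) ^ k)⁻¹ * ∑ b'' ∈ fiber (proj h) b, Real.exp (-(kapM (d + 1) a m2 L / 2 * tdistT M' (lift h b₀) b'')) := by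
  have := norm_effLapTw_inv_sub_apply_le_rate_cover h ha hm hL hk hn hω₁ hω₂ hθ (lift h b₀) b
  rwa [proj_lift] at this

/-- Decay at a base point with the canonical lift. [cite: King1986, (4.34) p.674] -/
theorem norm_effLapTw_inv_apply_le_decay_cover' (h : ∀ μ, M μ ∣ M' μ) {a m2 : ℝ} (ha : 0 < a) (hm : 0 < m2) {L k : ℕ} [NeZero L] (hL : 2 ≤ L) (hk : 1 ≤ k)
    {ω : Fin (d + 1) → ℂ} (hω : ∀ μ, ω μ ^ fine (L ^ k) M' μ = 1) (b₀ b : Tor M) :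
    ‖(effLapTw (L ^ k) M (aK a L k) (((L ^ k : ℕ) : ℝ) ^ 2) m2 ω)⁻¹ b₀ b‖
      ≤ (2 / gamM a m2 L) * ∑ b'' ∈ fiber (proj h) b, Real.exp (-(kapM (d + 1) a m2 L * tdistT M' (lift h b₀) b'')) := by
  have := norm_effLapTw_inv_apply_le_decay_cover h ha hm hL hk hω (lift h b₀) b
  rwa [proj_lift] at this

/-- ★★★ **PACKAGE — KING's LEMMA 4.5 AT A TORON OF FINITE-ORDER HOLONOMY** (decay + two-spacing rate with decay, periodised majorants, King's constants of the tree; positive constants).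
[cite: King1986, Lemma 4.5 (4.38) p.674, (4.34) p.674, (4.39)–(4.41) pp.674–675] -/
theorem effLapTw_toron_rate_package (h : ∀ μ, M μ ∣ M' μ) {a m2 : ℝ} (ha : 0 < a) (hm : 0 < m2) {L k n : ℕ} [NeZero L] (hL : 2 ≤ L) (hk : 1 ≤ k) (hn : 1 ≤ n)
    {ω₁ ω₂ : Fin (d + 1) → ℂ} (hω₁ : ∀ μ, ω₁ μ ^ fine (L ^ k) M' μ = 1) (hω₂ : ∀ μ, ω₂ μ ^ fine (L ^ n * L ^ k) M' μ = 1)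
    (hθ : ∀ μ, ω₂ μ ^ (L ^ n * L ^ k) = ω₁ μ ^ (L ^ k)) :
    0 < gamM a m2 L ∧ 0 < kapM (d + 1) a m2 L ∧ 0 ≤ CdiffM (d + 1) a m2 L ∧
    (∀ (b' : Tor M') (b : Tor M), ‖(effLapTw (L ^ k) M (aK a L k) (((L ^ k : ℕ) : ℝ) ^ 2) m2 ω₁)⁻¹ (proj h b') b‖
        ≤ (2 / gamM a m2 L) * ∑ b'' ∈ fiber (proj h) b, Real.exp (-(kapM (d + 1) a m2 L * tdistT M' b' b''))) ∧
    (∀ (b' : Tor M') (b : Tor M),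
      ‖(effLapTw (L ^ n * L ^ k) M (aK a L (k + n)) (((L ^ n * L ^ k : ℕ) : ℝ) ^ 2) m2 ω₂)⁻¹ (proj h b') b
          - (effLapTw (L ^ k) M (aK a L k) (((L ^ k : ℕ) : ℝ) ^ 2) m2 ω₁)⁻¹ (proj h b') b‖
        ≤ CdiffM (d + 1) a m2 L * ((L : ℝ) ^ k)⁻¹ * ∑ b'' ∈ fiber (proj h) b, Real.exp (-(kapM (d + 1) a m2 L / 2 * tdistT M' b' b''))) :=
  ⟨Literature.MathematicalPhysics.QuantumFieldTheory.King1986.Torus.gamM_pos ha hm hL,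
   (Literature.MathematicalPhysics.QuantumFieldTheory.King1986.Torus.kapM_pos_le (d := d + 1) ha hm hL).1,
   Literature.MathematicalPhysics.QuantumFieldTheory.King1986.Torus.CdiffM_nonneg ha hm hL,
   fun b' b => norm_effLapTw_inv_apply_le_decay_cover h ha hm hL hk hω₁ b' b,
   fun b' b => norm_effLapTw_inv_sub_apply_le_rate_cover h ha hm hL hk hn hω₁ hω₂ hθ b' b⟩

end Base

end Summit.QuantumFields.YangMills.BalabanUVNodes.N15KingModelRung.Cover

end
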